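import Summits.Ventures.YMGap.RobustBall.RobustSlabDoorWeighted
import Summits.Ventures.YMGap.RobustBall.AreaLawWDefs
import Summits.Ventures.YMGap.RobustBall.TorusDoor
import HarnessLib

/-!
# Robust ball (Y2), area-law side — `AreaLawOnBallW` (TIER 2, vertical window) from a one-link modulus

HONEST FRAMING: venture file of the cell `pub-ymgap` (QuantumFields programme), track ROBUST-BALL (ds-4).  THE BOOKKEEPING that closes the
TIER-2 area-law chain (`HOME/rb/ROBUST-BALL-STATEMENT.md` §6(b), K1 residual 1(b)): for a member `W` of rb-theory's diameter-weighted ball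
`ClusterDomain κ ε₀ ε₁` (NO range cut-off: per-link oscillation load `∑_{X ∋ e} e^{κ diam X} osc_e W_X ≤ ε₀`, self + cross Lipschitz loads
`≤ ε₁` with the same weights) which is slab-local with vertical dependence diameter `mv` (`IsSlabLocal mv W`), the abstract data of the
WEIGHTED robust slab door (`RobustSlabDoorWeighted`) for `W.total` are supplied: neighbourhoods = ALL other slice sites (so the finite-range
hypothesis is void), oscillation `δ = ε₀`, self-Lipschitz `ℓ = ε₁`, cross coefficients `Λ(x̄,ȳ) = crossLip(e_x̄, e_ȳ)` whose rows WEIGHTED by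
`e^{τ d_graph(x̄,ȳ)}` are `≤ ε₁` as soon as `τ·n ≤ κ` (`d_graph ≤ n‖·‖_∞ ≤ n·diam X` for two links of one polymer).  Results:
* `areaLawOnBallW_of_slabCovariance` — rb-p2's robust Durhuus–Fröhlich criterion is RANGE-FREE (it consumes only the vertical window and the
  centre invariance), so its assembly goes through verbatim on the tier-2 ball;
* `areaLawOnBallW_of_oneLinkKRModulus` — a one-link modulus `OneLinkKRModulus N R K` on the slab ball `R ≥ 2n|β/N|`, `κ > 0`, and the WEIGHTED
  row condition `e^{κ/n}·e^{ε₀}(1 + 2√N ε₁)·2n|β/N|K + √N ε₁ < 1` give `AreaLawOnBallW N (n+1) β κ ε₀ ε₁ mv` for every `mv ≥ 1`: Wilson's AREA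
  LAW for the loop expectation under EVERY member's measure, constants uniform on the ball, rate `κ/(2 n mv)`.
The window is only VERTICAL; horizontally the members have infinite range.  (§6(a), no window at all, is FALSE — lit-1's loop-screening
member; §6(c) is method-null.)  Strong-coupling finite-lattice statement; nothing about the continuum, a mass gap, or Clay.
-/

noncomputable section

open MeasureTheory ProbabilityTheory
open Literature.Probability.LatticeModels hiding glue
open Literature.Probability.LatticeModels.DobrushinMetric
open Literature.MathematicalPhysics.QuantumLattice (fundamentalRep continuous_fundamentalRep fundamentalRep_apply)
open Literature.MathematicalPhysics.QuantumFieldTheory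
open Literature.MathematicalPhysics.QuantumFieldTheory.DurhuusFrohlich
open Literature.MathematicalPhysics.QuantumFieldTheory.Balaban1983to89.StrongCouplingDobrushinWindow (OneLinkKRModulus)

namespace Summit.Ventures.YMGap.RobustBall

variable {n L N : ℕ} [NeZero L]

/-! ### Geometry: slice graph distance against the torus `ℓ∞` distance -/

section Geometry

omit [NeZero L] in
/-- The slice graph distance (`ℓ¹`) is at most `n` times the torus `ℓ∞` distance of the inserted sites. [folklore] -/
theorem torusGraphDist_le_mul_torusNorm (v : Fin (n + 1)) (t : ZMod L) (x y : TorusSite n L) :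
    torusGraphDist x y ≤ n * torusNorm (ins v t x - ins v t y) := by
  have hk : ∀ k : Fin n, ((x k - y k).valMinAbs).natAbs ≤ torusNorm (ins v t x - ins v t y) := by
    intro k
    have h := natAbs_valMinAbs_le_torusNorm (ins v t x - ins v t y) (v.succAbove k)
    have hc : (ins v t x - ins v t y) (v.succAbove k) = x k - y k := by simp [ins]
    rwa [hc] at h
  unfold torusGraphDist
  calc ∑ k, ((x k - y k).valMinAbs).natAbs ≤ ∑ _k : Fin n, torusNorm (ins v t x - ins v t y) :=
        Finset.sum_le_sum fun k _ => hk k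
    _ = n * torusNorm (ins v t x - ins v t y) := by simp

omit [NeZero L] in
/-- Weight comparison: `τ d_graph(x̄,ȳ) ≤ κ ‖ins x̄ − ins ȳ‖_∞` when `0 ≤ τ`, `τ n ≤ κ`. [folklore] -/
theorem weight_le_of_mul_le {κ τ : ℝ} (hτ : 0 ≤ τ) (hτκ : τ * n ≤ κ) (v : Fin (n + 1)) (t : ZMod L)
    (x y : TorusSite n L) :
    τ * (torusGraphDist x y : ℝ) ≤ κ * (torusNorm (ins v t x - ins v t y) : ℝ) := by
  have h1 : (torusGraphDist x y : ℝ) ≤ (n : ℝ) * torusNorm (ins v t x - ins v t y) := by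
    exact_mod_cast torusGraphDist_le_mul_torusNorm v t x y
  have h0 : (0 : ℝ) ≤ torusNorm (ins v t x - ins v t y) := Nat.cast_nonneg _
  calc τ * (torusGraphDist x y : ℝ) ≤ τ * ((n : ℝ) * torusNorm (ins v t x - ins v t y)) :=
        mul_le_mul_of_nonneg_left h1 hτ
    _ = (τ * n) * torusNorm (ins v t x - ins v t y) := by ring
    _ ≤ κ * torusNorm (ins v t x - ins v t y) := mul_le_mul_of_nonneg_right hτκ h0

end Geometry

/-! ### The weighted door data of a member of the tier-2 ball -/

section Loads

variable {v : Fin (n + 1)} {t : ZMod L} (W : Perturbation (n + 1) L N)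
  (rr : {e : Edge (n + 1) L // ¬ IsSlab v t e} → SU N)

/-- **(hdep) is void on the full neighbourhood**: boundary conditions agreeing on `slabNbr x̄ ∪ (univ ∖ {x̄})` give the same site
re-weighting. [folklore] -/
theorem siteTiltW_total_dep_univ (x : TorusSite n L) (η η' : TorusSite n L → SU N)
    (h : ∀ z ∈ Slab.slabNbr x ∪ Finset.univ.erase x, η z = η' z) :
    ∃ c : ℝ, ∀ g, siteTiltW v t W.total rr x η g = c + siteTiltW v t W.total rr x η' g := by
  classical
  refine ⟨0, fun g => ?_⟩
  have hupd : Function.update η x g = Function.update η' x g := by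
    funext z
    by_cases hz : z = x
    · subst hz; simp
    · rw [Function.update_of_ne hz, Function.update_of_ne hz,
        h z (Finset.mem_union_right _ (Finset.mem_erase.2 ⟨hz, Finset.mem_univ _⟩))]
  simp only [siteTiltW, hupd, zero_add]

/-- **(hroww)**: the cross coefficients of the door, WEIGHTED by `e^{τ d_graph(x̄,ȳ)}` with `τ n ≤ κ`, have rows bounded by the
`κ`-weighted cross-Lipschitz load at the vertical link (`d_graph(x̄,ȳ) ≤ n‖e_x̄ − e_ȳ‖_∞ ≤ n diam X` for `X ∋ e_x̄, e_ȳ`). [folklore] -/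
theorem crossCoeff_weighted_rowsum_le (w : LoadWitness W) {κ τ : ℝ} (hκ : 0 ≤ κ) (hτ : 0 ≤ τ) (hτκ : τ * n ≤ κ)
    (nbrW : TorusSite n L → Finset (TorusSite n L)) (x : TorusSite n L) :
    ∑ y ∈ Slab.slabNbr x ∪ nbrW x, crossCoeff W w v t x y * Real.exp (τ * torusGraphDist x y) ≤
      w.crossLipLoad κ (vlinkAt v t x) := by
  classical
  have hdiag : crossCoeff W w v t x x = 0 := by simp [crossCoeff]
  have hnn : ∀ y, 0 ≤ crossCoeff W w v t x y * Real.exp (τ * torusGraphDist x y) := fun y =>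
    mul_nonneg (crossCoeff_nonneg W w x y) (Real.exp_pos _).le
  have hinj : ∀ y ∈ Finset.univ.erase x, ∀ y' ∈ Finset.univ.erase x, vlinkAt v t y = vlinkAt v t y' → y = y' :=
    fun y _ y' _ hyy' => ins_injective' (congrArg Prod.fst hyy')
  calc ∑ y ∈ Slab.slabNbr x ∪ nbrW x, crossCoeff W w v t x y * Real.exp (τ * torusGraphDist x y)
      ≤ ∑ y ∈ Finset.univ, crossCoeff W w v t x y * Real.exp (τ * torusGraphDist x y) :=
        Finset.sum_le_sum_of_subset_of_nonneg (Finset.subset_univ _) fun y _ _ => hnn y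
    _ = ∑ y ∈ Finset.univ.erase x, crossCoeff W w v t x y * Real.exp (τ * torusGraphDist x y) := by
        rw [← Finset.sum_erase_add _ _ (Finset.mem_univ x), hdiag, zero_mul, add_zero]
    _ ≤ ∑ y ∈ Finset.univ.erase x, w.crossLip 0 (vlinkAt v t x) (vlinkAt v t y) *
          Real.exp (κ * torusNorm ((vlinkAt v t x).1 - (vlinkAt v t y).1)) := by
        refine Finset.sum_le_sum fun y hy => ?_
        rw [crossCoeff, if_neg (Finset.ne_of_mem_erase hy)]
        exact mul_le_mul_of_nonneg_left (Real.exp_le_exp.2 (weight_le_of_mul_le hτ hτκ v t x y)) (crossLip_nonneg w 0 _ _)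
    _ = ∑ e ∈ (Finset.univ.erase x).image (vlinkAt v t), w.crossLip 0 (vlinkAt v t x) e *
          Real.exp (κ * torusNorm ((vlinkAt v t x).1 - e.1)) := by
        rw [Finset.sum_image hinj]
    _ ≤ ∑ e ∈ Finset.univ.erase (vlinkAt v t x), w.crossLip 0 (vlinkAt v t x) e *
          Real.exp (κ * torusNorm ((vlinkAt v t x).1 - e.1)) := by
        refine Finset.sum_le_sum_of_subset_of_nonneg (fun e he => ?_) fun e _ _ =>
          mul_nonneg (crossLip_nonneg w 0 _ _) (Real.exp_pos _).le
        obtain ⟨y, hy, rfl⟩ := Finset.mem_image.1 he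
        exact Finset.mem_erase.2
          ⟨fun h => Finset.ne_of_mem_erase hy (ins_injective' (congrArg Prod.fst h)), Finset.mem_univ _⟩
    _ ≤ w.crossLipLoad κ (vlinkAt v t x) := sum_erase_crossLip_mul_exp_le w hκ _

end Loads


/-! ### Tier 2 contains tier 1 (the area-law currencies compared) -/

section Inclusion

variable {d : ℕ}

omit [NeZero L] in
/-- Pointwise weight bookkeeping for a truncated load: `e^{κ diam X}·(𝟙[diam X ≤ r]·a) ≤ e^{κ r}·(e^{0·diam X}·a)` for `κ, a ≥ 0`. [folklore] -/
theorem exp_mul_truncate_le {κ a : ℝ} (hκ : 0 ≤ κ) (ha : 0 ≤ a) (r : ℕ) (X : Finset (Site d L)) :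
    Real.exp (κ * polymerDiam X) * (if r < polymerDiam X then 0 else a) ≤
      Real.exp (κ * r) * (Real.exp (0 * (polymerDiam X : ℝ)) * a) := by
  rw [zero_mul, Real.exp_zero, one_mul]
  split_ifs with h
  · rw [mul_zero]; positivity
  · push Not at h
    exact mul_le_mul_of_nonneg_right (Real.exp_le_exp.2 (mul_le_mul_of_nonneg_left (by exact_mod_cast h) hκ)) ha

/-- **TIER 2 CONTAINS TIER 1**: a member of the finite-range ball `ClusterDomainFR ε₀' ε₁' r` lies in the diameter-weighted ball
`ClusterDomain κ ε₀ ε₁` as soon as `κ ≥ 0` and `e^{κ r} ε₀' ≤ ε₀`, `e^{κ r} ε₁' ≤ ε₁` (truncate the load witness to the polymers of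
diameter `≤ r`, where alone the activities are non-zero, and weigh them by `e^{κ diam X} ≤ e^{κ r}`). [folklore] -/
theorem clusterDomainFR_subset_clusterDomain {κ ε₀ ε₁ ε₀' ε₁' : ℝ} {r : ℕ} (hκ : 0 ≤ κ)
    (h₀ : Real.exp (κ * r) * ε₀' ≤ ε₀) (h₁ : Real.exp (κ * r) * ε₁' ≤ ε₁) :
    (ClusterDomainFR ε₀' ε₁' r : Set (Perturbation d L N)) ⊆ ClusterDomain κ ε₀ ε₁ := by
  classical
  rintro W ⟨hr, w, hw₀, hw₁⟩
  have her : 0 ≤ Real.exp (κ * r) := (Real.exp_pos _).le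
  refine ⟨⟨fun X e => if r < polymerDiam X then 0 else w.osc X e,
    fun X e => if r < polymerDiam X then 0 else w.lip X e, ?_, ?_⟩, ?_, ?_⟩
  · intro X
    by_cases h : r < polymerDiam X
    · refine ⟨fun _ => by simp [h], fun y σ τ _ => ?_⟩
      simp only [if_pos h, hr X h, Pi.zero_apply, sub_self, abs_zero, le_refl]
    · refine ⟨fun y => by simp only [if_neg h]; exact (w.osc_spec X).nonneg y, fun y σ τ hστ => ?_⟩
      simp only [if_neg h]
      exact (w.osc_spec X).le y σ τ hστ
  · intro X
    by_cases h : r < polymerDiam X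
    · refine ⟨fun _ => by simp [h], fun y σ τ _ => ?_⟩
      simp only [if_pos h, hr X h, Pi.zero_apply, sub_self, abs_zero, zero_mul, le_refl]
    · refine ⟨fun y => by simp only [if_neg h]; exact (w.lip_spec X).nonneg y, fun y σ τ hστ => ?_⟩
      simp only [if_neg h]
      exact (w.lip_spec X).le y σ τ hστ
  · -- weighted oscillation load `≤ e^{κ r} a_0(e) ≤ e^{κ r} ε₀' ≤ ε₀`
    intro e
    refine le_trans ?_ h₀
    simp only [LoadWitness.oscLoad]
    calc ∑ X ∈ polymersThroughEdge e, Real.exp (κ * polymerDiam X) * (if r < polymerDiam X then 0 else w.osc X e)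
        ≤ ∑ X ∈ polymersThroughEdge e, Real.exp (κ * r) * (Real.exp (0 * (polymerDiam X : ℝ)) * w.osc X e) :=
          Finset.sum_le_sum fun X _ => exp_mul_truncate_le hκ ((w.osc_spec X).nonneg e) r X
      _ = Real.exp (κ * r) * w.oscLoad 0 e := by rw [← Finset.mul_sum]; rfl
      _ ≤ Real.exp (κ * r) * ε₀' := mul_le_mul_of_nonneg_left (hw₀ e) her
  · -- weighted Lipschitz loads `≤ e^{κ r} (ℓ_{s,0}(e) + Λ_0(e)) ≤ e^{κ r} ε₁' ≤ ε₁`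
    intro e
    refine le_trans ?_ h₁
    have hs : (∑ X ∈ polymersThroughEdge e, Real.exp (κ * polymerDiam X) * (if r < polymerDiam X then 0 else w.lip X e)) ≤
        Real.exp (κ * r) * w.selfLipLoad 0 e := by
      calc ∑ X ∈ polymersThroughEdge e, Real.exp (κ * polymerDiam X) * (if r < polymerDiam X then 0 else w.lip X e)
          ≤ ∑ X ∈ polymersThroughEdge e, Real.exp (κ * r) * (Real.exp (0 * (polymerDiam X : ℝ)) * w.lip X e) :=
            Finset.sum_le_sum fun X _ => exp_mul_truncate_le hκ ((w.lip_spec X).nonneg e) r X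
        _ = Real.exp (κ * r) * w.selfLipLoad 0 e := by rw [← Finset.mul_sum]; rfl
    have hc : (∑ y ∈ Finset.univ.erase e, ∑ X ∈ (polymersThroughEdge e).filter (fun X => y ∈ polymerEdges 1 X),
        Real.exp (κ * polymerDiam X) * (if r < polymerDiam X then 0 else w.lip X y)) ≤
        Real.exp (κ * r) * w.crossLipLoad 0 e := by
      simp only [LoadWitness.crossLipLoad, LoadWitness.crossLip, Finset.mul_sum]
      exact Finset.sum_le_sum fun y _ => Finset.sum_le_sum fun X _ =>
        exp_mul_truncate_le hκ ((w.lip_spec X).nonneg y) r X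
    have hsum : Real.exp (κ * r) * w.selfLipLoad 0 e + Real.exp (κ * r) * w.crossLipLoad 0 e ≤ Real.exp (κ * r) * ε₁' := by
      rw [← mul_add]; exact mul_le_mul_of_nonneg_left (hw₁ e) her
    simp only [LoadWitness.selfLipLoad, LoadWitness.crossLipLoad, LoadWitness.crossLip]
    simp only [LoadWitness.selfLipLoad, LoadWitness.crossLipLoad, LoadWitness.crossLip] at hs hc hsum
    linarith [hs, hc, hsum]

/-- **The tier-2 area law implies the tier-1 area law** (rb-theory's §1.4 «tier 2 contains tier 1», literal for the currency C-AL):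
`AreaLawOnBallW N d β κ ε₀ ε₁ mv`, `κ ≥ 0`, `e^{κ r} ε₀' ≤ ε₀`, `e^{κ r} ε₁' ≤ ε₁` give `AreaLawOnBall N d β ε₀' ε₁' r mv` with the same
constants. [folklore] -/
theorem AreaLawOnBallW.areaLawOnBall {β κ ε₀ ε₁ ε₀' ε₁' : ℝ} {r mv : ℕ} (h : AreaLawOnBallW N d β κ ε₀ ε₁ mv) (hκ : 0 ≤ κ)
    (h₀ : Real.exp (κ * r) * ε₀' ≤ ε₀) (h₁ : Real.exp (κ * r) * ε₁' ≤ ε₁) : AreaLawOnBall N d β ε₀' ε₁' r mv := by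
  obtain ⟨C, c, hc, hW⟩ := h
  exact ⟨C, c, hc, fun L _ W hW' hloc x i j R T hij hR hT hRL hTL =>
    hW L W (clusterDomainFR_subset_clusterDomain hκ h₀ h₁ hW') hloc x i j R T hij hR hT hRL hTL⟩

end Inclusion

/-! ### The tier-2 ball area law from a one-link modulus -/

section Ball

/-- **WEIGHTED SLAB COVARIANCE DECAY FOR A MEMBER OF THE TIER-2 BALL.**  Let `OneLinkKRModulus N R K` be a one-link modulus on the slab
ball `R ≥ 2n|βt|` ('t Hooft `βt = β/N`), `0 ≤ τ`, `τ n ≤ κ`, `0 ≤ ε₁`, and suppose the WEIGHTED ROW CONDITION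
`e^{τ}·e^{ε₀}(1 + 2√N ε₁)·(2n|βt|K) + √N ε₁ < 1`.  Then for every torus `L`, every `W ∈ ClusterDomain κ ε₀ ε₁`, every direction, height,
off-slab configuration, slice sites `x̄, ȳ`, indices and `φ, ψ ∈ {Re, Im}`:
`|Cov_{slabLawW}(φ(Q_x̄)_{ij}, ψ(Q_ȳ⁻¹)_{kl})| ≤ 8N e^{-τ d_graph(x̄,ȳ)}`.  Chain: door data of the member (`siteTiltW_total_*`, weighted cross rows
`crossCoeff_weighted_rowsum_le`) → weighted robust slab door (`slabLawW_entry_cov_le_weighted`). [cite: Follmer1988, Ch. I Corollary (2.14)] -/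
theorem slabCovarianceW_of_oneLinkKRModulus (hN : 1 ≤ N) (βt : ℝ) {R K : ℝ} (hK : 0 ≤ K) (hmod : OneLinkKRModulus N R K)
    (hR : |βt| * (2 * (n : ℝ)) ≤ R) {κ τ ε₀ ε₁ : ℝ} (hκ : 0 ≤ κ) (hτ : 0 ≤ τ) (hτκ : τ * n ≤ κ) (h₁ : 0 ≤ ε₁) (mv : ℕ)
    (hc : Real.exp τ * (Real.exp ε₀ * (1 + 2 * Real.sqrt N * ε₁) * (2 * (n : ℝ) * |βt| * K)) + Real.sqrt N * ε₁ < 1)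
    (L : ℕ) [NeZero L] (W : Perturbation (n + 1) L N) (hWball : W ∈ ClusterDomain κ ε₀ ε₁) (_hWloc : IsSlabLocal mv W)
    (v : Fin (n + 1)) (t : ZMod L) (rest : {e : Edge (n + 1) L // ¬ IsSlab v t e} → SU N) (x y : Site n L)
    (i j k l : Fin N) (φ ψ : ℂ → ℝ) (hφ : φ = Complex.re ∨ φ = Complex.im) (hψ : ψ = Complex.re ∨ ψ = Complex.im) :
    |cov[fun Q => φ ((Q x : Matrix (Fin N) (Fin N) ℂ) i j),
        fun Q => ψ ((((Q y)⁻¹ : Matrix.specialUnitaryGroup (Fin N) ℂ) : Matrix (Fin N) (Fin N) ℂ) k l);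
        slabLawW v t βt W.total rest]| ≤
      8 * N * Real.exp (-τ * torusGraphDist x y) := by
  classical
  obtain ⟨w, hosc, hlip⟩ := hWball
  have hsl : ∀ e, w.selfLipLoad 0 e ≤ ε₁ := fun e =>
    (selfLipLoad_zero_le w hκ e).trans
      (le_trans (le_add_of_nonneg_right (crossLipLoad_nonneg w κ e)) (hlip e))
  have hcl : ∀ e, w.crossLipLoad κ e ≤ ε₁ := fun e =>
    le_trans (le_add_of_nonneg_left (selfLipLoad_nonneg w κ e)) (hlip e)
  exact slabLawW_entry_cov_le_weighted (n := n) (L := L) (N := N) (W := W.total) hN v t (β := βt) (R := R) (K := K)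
    (δ := ε₀) (ℓ := ε₁) (Λt := ε₁) (τ := τ) hK h₁ hR hmod W.measurable_total W.exists_abs_total_le rest
    (fun x' => Finset.univ.erase x') (fun x' => Finset.notMem_erase x' _)
    (fun x' η η' h => siteTiltW_total_dep_univ W rest x' η η' h)
    (fun x' ω g g' => (siteTiltW_total_osc W rest w x' ω g g').trans ((oscLoad_zero_le w hκ _).trans (hosc _)))
    (fun x' ω g g' => (siteTiltW_total_lip W rest w x' ω g g').trans
      (mul_le_mul_of_nonneg_right (hsl _) (suFrobDist_nonneg _ _)))
    (crossCoeff W w v t) (fun x' y' => crossCoeff_nonneg W w x' y')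
    (fun x' y' ω η h => siteTiltW_total_cross W rest w x' y' h) hτ
    (fun x' => (crossCoeff_weighted_rowsum_le W w hκ hτ hτκ _ x').trans (hcl _)) le_rfl hc
    x y i j k l φ ψ hφ hψ

/-- **AREA LAW ON THE TIER-2 BALL FROM WEIGHTED SLAB CLUSTERING** (tier-2 twin of rb-p2's `areaLawOnBall_of_slabCovariance`; the robust
Durhuus–Fröhlich criterion is RANGE-FREE).  Let `N ≥ 2`, `β` the TREE coupling, `mv ≥ 1`.  If for every torus `L`, every
`W ∈ ClusterDomain κ ε₀ ε₁` with `IsSlabLocal mv W`, every direction `v`, height `t` and off-slab configuration, the perturbed slab law clusters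
with constants `(C₁, C₂)`, `C₂ > 0`, then `AreaLawOnBallW N (n+1) β κ ε₀ ε₁ mv` with the explicit constants of `robust_slab_criterion`
(`C = max(max(N, e^{(C₂/2mv)M₀²}), 1)`, `c = C₂/(2mv)`). [cite: CaoNissimSheffield2025dynamical, Theorem 2.3] -/
theorem areaLawOnBallW_of_slabCovariance (hN : 2 ≤ N) (β κ ε₀ ε₁ : ℝ) {mv : ℕ} (hmv : 1 ≤ mv) {C₁ C₂ : ℝ}
    (hC₂ : 0 < C₂)
    (hdoor : ∀ (L : ℕ) [NeZero L] (W : Perturbation (n + 1) L N), W ∈ ClusterDomain κ ε₀ ε₁ → IsSlabLocal mv W →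
      ∀ (v : Fin (n + 1)) (t : ZMod L) (rest : {e : Edge (n + 1) L // ¬ IsSlab v t e} → SU N) (x y : Site n L)
        (i j k l : Fin N) (φ ψ : ℂ → ℝ), (φ = Complex.re ∨ φ = Complex.im) → (ψ = Complex.re ∨ ψ = Complex.im) →
          |cov[fun Q => φ ((Q x : Matrix (Fin N) (Fin N) ℂ) i j),
              fun Q => ψ ((((Q y)⁻¹ : Matrix.specialUnitaryGroup (Fin N) ℂ) : Matrix (Fin N) (Fin N) ℂ) k l);
              slabLawW v t (β / N) W.total rest]| ≤ C₁ * Real.exp (-C₂ * torusGraphDist x y)) :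
    AreaLawOnBallW N (n + 1) β κ ε₀ ε₁ mv := by
  set A₀ : ℝ := max (N : ℝ) (Real.exp (C₂ / (2 * mv) *
    (2 * Real.log (max (((N : ℝ) ^ 2) ^ mv * (4 * C₁)) 1) / C₂) ^ 2)) with hA₀
  refine ⟨max A₀ 1, C₂ / (2 * mv), div_pos hC₂ (by positivity), ?_⟩
  intro L _ W hWball hWloc x i j R T hij hR hT hRL hTL
  have hNr : (N : ℝ) ≠ 0 := by exact_mod_cast (show N ≠ 0 by omega)
  have hβ : (N : ℝ) * (β / N) = β := by field_simp
  have h := robust_slab_criterion_quasiLocal (n := n) (L := L) hN (β / N) W hmv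
    (fun v => hasVerticalRange_total_of_isSlabLocal hWloc v)
    (fun v t U => total_slabRotate_centre_of_isSlabLocal (by omega) hWloc v t U) hC₂
    (fun v t rest x' y' i' j' k' l' φ ψ hφ hψ => hdoor L W hWball hWloc v t rest x' y' i' j' k' l' φ ψ hφ hψ) x hij hRL hTL
  rw [hβ] at h
  exact areaLaw_shape_of_le (by omega) h

/-- **AREA LAW ON THE TIER-2 BALL FROM A ONE-LINK MODULUS (weighted row condition)** — ROBUST-BALL-STATEMENT §6(b).  Let `N ≥ 2`, slice
dimension `n ≥ 1`, `β` the tree coupling ('t Hooft `β/N`), `OneLinkKRModulus N R K` a one-link Kantorovich–Rubinstein modulus on the slab ball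
`R ≥ 2n|β/N|`, `κ > 0`, `0 ≤ ε₁`, a vertical diameter `mv ≥ 1`, and suppose the WEIGHTED ROW CONDITION
`e^{κ/n}·e^{ε₀}(1 + 2√N ε₁)·(2n|β/N|K) + √N ε₁ < 1`.  Then `AreaLawOnBallW N (n+1) β κ ε₀ ε₁ mv`: there are `C, c > 0` (`c = κ/(2 n mv)`) such
that for every torus `L`, every member `W` of the diameter-weighted ball `ClusterDomain κ ε₀ ε₁` — NO range cut-off — with `IsSlabLocal mv W`,
and every rectangular `R×T` loop with `2R, 2T ≤ L`, `|⟨W_{R×T}⟩_{μ_{β,W,L}}| ≤ C^{2(R+T)} e^{-cRT}`.  Chain: member's weighted door data →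
weighted robust slab door (Föllmer's `κ̄ < 1`, rate `κ/n` per slice unit) → robust Durhuus–Fröhlich criterion.
[cite: Follmer1988, Ch. I Corollary (2.14)] [cite: CaoNissimSheffield2025dynamical, Theorem 2.3] -/
theorem areaLawOnBallW_of_oneLinkKRModulus (hN : 2 ≤ N) (hn : 1 ≤ n) (β : ℝ) {R K : ℝ} (hK : 0 ≤ K)
    (hmod : OneLinkKRModulus N R K) (hR : |β / N| * (2 * (n : ℝ)) ≤ R) {κ ε₀ ε₁ : ℝ} (hκ : 0 < κ) (h₁ : 0 ≤ ε₁)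
    {mv : ℕ} (hmv : 1 ≤ mv)
    (hc : Real.exp (κ / n) * (Real.exp ε₀ * (1 + 2 * Real.sqrt N * ε₁) * (2 * (n : ℝ) * |β / N| * K)) + Real.sqrt N * ε₁ < 1) :
    AreaLawOnBallW N (n + 1) β κ ε₀ ε₁ mv := by
  have hn' : (0 : ℝ) < n := by exact_mod_cast (show 0 < n by omega)
  have hτ : 0 ≤ κ / n := div_nonneg hκ.le hn'.le
  have hτκ : κ / n * n ≤ κ := (div_mul_cancel₀ κ hn'.ne').le
  refine areaLawOnBallW_of_slabCovariance (n := n) hN β κ ε₀ ε₁ hmv (C₁ := 8 * N) (C₂ := κ / n) (div_pos hκ hn') ?_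
  intro L _ W hWball hWloc v t rest x y i j k l φ ψ hφ hψ
  exact slabCovarianceW_of_oneLinkKRModulus (by omega) (β / N) hK hmod hR hκ.le hτ hτκ h₁ mv hc L W hWball hWloc v t rest
    x y i j k l φ ψ hφ hψ

end Ball

end Summit.Ventures.YMGap.RobustBall
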